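import Mathlib
import HarnessLib
import Summits.NavierStokesRegularity.NavierStokesRegularity.Theorems.TaylorModelRungThreeCertificateFormatVInterpW

/-!
# Crux K1b-DR (stmt-NavierStokesRegularity-23954), line `taylor-model` — v3 certificate: the TUBE-GROWTH CHECKER
# (clauses (R2)/(R3) of `ReadoutsV`; PROPAGATE-V-SPEC-cert1 §10 «split-vector», multi-split at the chunk boundaries;
# tm-g4 g4, keyed by engine-1 g67 12:33Z)

Definitions only (the soundness file `…FormatVGrowthSound` turns the Booleans into the hypotheses `hR2/hR3a/hR3b` of
`CertTablesV.k1bDR_of_checksVR`).  Per stage `j` (kernel boxes `M_s := (coreVW j s).M`, `S := S j`, chunk length `L`,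
chunk boundaries `C_q := q·L`):

* EMITTED GROWTH DATA (layout of `stageV j .landAux`, fixed HERE): `landAux[0][0] = gL1` — per sub-step the row factor
  `L1_s` the core step used (verified `(coreVW j s).L1 ≤ gL1[s]` inside the chunk run); `landAux[1][a] = gU a` — per start
  `a` a vector `ũ_a ≥ |[M_{C−1}]⋯[M_a]|·ω_j↑` up to the next chunk boundary `C` (verified in the chunk run of `a`);
  `landAux[2+q] = gT q` — per chunk `q` a nonnegative `n×n` dyadic matrix `T̃_q ≥ |[M_{C_{q+1}−1}]⋯[M_{C_q}]|` entrywise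
  (verified in chunk `q`'s run). Both claims are only required (and only used) when a later chunk exists.
* `prodM j a n` — THE MATHEMATICAL INTERVAL PRODUCT `[M_{a+n−1}]⋯[M_a]` (`n = 0`: identity; `n = 1`: `M_a`); the chunk run
  computes exactly these values incrementally (invariant of the soundness file), never by this definition.
* `GCtx` — the per-chunk context (all reads hoisted); `GCtx.facOf P w := max_r ((|P|·w)↑_r · (ω_j⁻¹)↑_r)` — the dyadic growth
  factor of an interval matrix against a weight vector;
  `gD j L a b` — THE TABLE `G_j(a,b)` as a dyadic: in-chunk pairs (`b ≤ C_{a/L+1}`) `facOf (prodM a (b−a)) ω↑`, cross-chunk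
  pairs `facOf (prodM C_{q_b} (b − C_{q_b})) w` with `w = T̃_{q_b−1}⋯T̃_{a/L+1}·ũ_a` (`wVec`), `q_b := (b−1)/L`.
* `GCtx.pairTest a' b fac` — the (R3a) inequalities of the pair `(a'−1, b)`: `gL1[a'−1]·fac ≤ Λdes_j↓` and, for `b < S`,
  `gL1[a'−1]·fac·gL1[b] ≤ Λ_j↓` (vacuous for `a' = 0`); `checkL1 j` — (R3b) `gL1[a] ≤ Λ_j↓` for `a < S`.
* `growthRun P j G k s N pre` (`G = gctx j L q`) — THE CHUNK RUN (pattern of `StageCtx.runFromP`): ONE forward replay of chunk `q` from its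
  start state carrying the running products `pre[i] = P(s ← C_q+i)`; at each sub-step it conjoins the chain Boolean `o.ok`, the
  caller's per-sub-step predicate `P s o.core` (e.g. the read-outs' (R4)), `o.core.L1 ≤ gL1[s]`, and the pair tests of all pairs
  `(a', s+1)` (`a'` in the chunk: in-chunk factor; `a' < C_q`: split factor with `P(s+1 ← C_q)` and `wVec`; `a' = s+1`: identity);
  at the chunk end it verifies the emitted claims `T̃_q`, `ũ_a`. `growthRange P j L q` starts it from `startNode C_q`.

* `checkR0 j` ((R0 a–d): `TnD S ≤ τs↓`, `0 < γ`, `0 ≤ Λdes`, base point in its polytope by `faceTest0` per listed face),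
  `checkR1 j` ((R1): `tubeW ≤ wT` coordinatewise).

Cost per chunk: `L(L−1)/2` interval `n³`-products for the in-chunk prefixes (the forward product is one of them) plus `O(S·n²)` row
sums per sub-step; nothing outside the chunk is recomputed. MODEL-lattice bookkeeping only (rung TL-M3); nothing here is a
statement about the Navier–Stokes equations, and nothing is asserted.
-/

-- the sub-problem namespace repeats the summit name by design (D-0017)
set_option linter.dupNamespace false

namespace Summit.NavierStokesRegularity.NavierStokesRegularity.Theorems.TaylorModelCert

open scoped BigOperators

/-! ### Small dyadic helpers -/

/-- The identity as an interval matrix (point entries `1`/`0`). [folklore] -/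
def idIM (n : ℕ) : Array (Array IntervalD) :=
  Array.ofFn (n := n) fun r => Array.ofFn (n := n) fun c => if (r : ℕ) = c then IntervalD.ofInt 1 else IntervalD.ofInt 0

/-- `max_{r<k} v r` over dyadics (`0` for `k = 0`). [folklore] -/
def maxUpTo (v : ℕ → Dyad) : ℕ → Dyad
  | 0 => Dyad.zero
  | k + 1 => Dyad.max (maxUpTo v k) (v k)

/-- Entrywise `A ≤ B` for dyadic `n×n` matrices. [folklore] -/
def leMatD (n : ℕ) (A B : Array (Array Dyad)) : Bool :=
  allN n fun r => allN n fun c => Dyad.ble (dmget A r c) (dmget B r c)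

/-! ### The per-chunk context of the growth pass (everything read once) -/

/-- Per-chunk CONTEXT of the growth pass: window size / precision, chunk length `L`, chunk index `q`, sub-step count `S`; the
emitted row factors `gL1`, the weight ends `ω↑`, `(ω⁻¹)↑`, the two thresholds `Λdes↓`, `Λ↓`; the transported start vectors
`W[a']` (`a' < qL`), the emitted start vectors `U a` and the chunk's transfer claim `Tq`. [folklore] -/
structure GCtx where
  (n prec L q S : ℕ)
  (gL1 ωhi ωinvhi : Array Dyad)
  (ΛdesLo ΛLo : Dyad)
  W : Array (Array Dyad)
  U : ℕ → Array Dyad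
  Tq : Array (Array Dyad)

namespace GCtx

variable (G : GCtx)

/-- **Growth factor of an interval matrix against a weight vector**: `max_r ((|P|·w)↑_r · (ω⁻¹)↑_r)`. [folklore] -/
def facOf (P : Array (Array IntervalD)) (w : Array Dyad) : Dyad :=
  maxUpTo (fun r => Dyad.mulUp G.prec (dget (absMulVecUp G.n G.prec (magM G.n P) w) r) (dget G.ωinvhi r)) G.n

/-- **(R3a) for the pair `(a'−1, b)` with factor `fac`**: `gL1[a'−1]·fac ≤ Λdes↓`, and `gL1[a'−1]·fac·gL1[b] ≤ Λ↓` when `b < S`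
(vacuous for `a' = 0`). [folklore] -/
def pairTest (a' b : ℕ) (fac : Dyad) : Bool :=
  (a' == 0) ||
    (Dyad.ble (Dyad.mulUp G.prec (dget G.gL1 (a' - 1)) fac) G.ΛdesLo &&
      (decide (G.S ≤ b) || Dyad.ble (Dyad.mulUp G.prec (Dyad.mulUp G.prec (dget G.gL1 (a' - 1)) fac) (dget G.gL1 b)) G.ΛLo))

/-- ONE sub-step of the growth pass at sub-step `s`: extend the running products `pre[i] = P(s ← qL+i)` by the kernel box `M`,
then test `0 ≤ L1 ≤ gL1[s]` and every pair `(a', s+1)` (`a'` in the chunk: direct factor; `a' = s+1`: identity; `a' < qL`: split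
factor with `P(s+1 ← qL)` and `W[a']`). Returns the new products and the Boolean. [folklore] -/
def step (s : ℕ) (M : Array (Array IntervalD)) (coL1 : Dyad) (pre : Array (Array (Array IntervalD))) :
    Array (Array (Array IntervalD)) × Bool :=
  let pre' := (pre.map fun P => mulII G.n G.prec M P).push M
  let b := s + 1
  let okL1 := Dyad.ble Dyad.zero coL1 && Dyad.ble coL1 (dget G.gL1 s)
  let okIn := allN pre'.size fun i => G.pairTest (G.q * G.L + i) b (G.facOf (pre'.getD i #[]) G.ωhi)
  let okDiag := G.pairTest b b (G.facOf (idIM G.n) G.ωhi)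
  let okOut := allN (G.q * G.L) fun a' => G.pairTest a' b (G.facOf (pre'.getD 0 #[]) (G.W.getD a' #[]))
  (pre', okL1 && okIn && okDiag && okOut)

/-- The CLAIMS at the end `s` of the chunk (only if a later chunk exists): `|P(s ← qL)| ≤ T̃_q` entrywise and
`(|P(s ← a)|·ω↑)↑ ≤ ũ_a` for every start `a` of the chunk. [folklore] -/
def claimsOK (s : ℕ) (pre : Array (Array (Array IntervalD))) : Bool :=
  decide (G.S ≤ s) ||
    (leMatD G.n (magM G.n (pre.getD 0 #[])) G.Tq &&
      allN pre.size fun i => leVec G.n (absMulVecUp G.n G.prec (magM G.n (pre.getD i #[])) G.ωhi) (G.U (G.q * G.L + i)))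

end GCtx

namespace CertTablesV

variable (TV : CertTablesV) (kitOf : ℕ → CoreKit) (wT : ℕ → Array Dyad)

/-! ### Emitted growth data: the layout of `stageV.landAux` -/

/-- `gL1 j` — per sub-step `s` an upper bound of the row factor `L1_s` the core step used (`landAux[0][0]`). [folklore] -/
def gL1 (j : ℕ) : Array Dyad := ((TV.stageV j).landAux.getD 0 #[]).getD 0 #[]

/-- `gU j a` — the emitted start vector `ũ_a` (`landAux[1][a]`, `n` dyadics). [folklore] -/
def gU (j a : ℕ) : Array Dyad := ((TV.stageV j).landAux.getD 1 #[]).getD a #[]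

/-- `gT j q` — the emitted chunk transfer magnitude matrix `T̃_q` (`landAux[2+q]`, `n×n` nonnegative dyadics). [folklore] -/
def gT (j q : ℕ) : Array (Array Dyad) := (TV.stageV j).landAux.getD (q + 2) #[]

/-- Upper ends of the weight enclosures: `ω_j↑`. [folklore] -/
def ωhiV (j : ℕ) : Array Dyad := Array.ofFn (n := TV.base.n) fun c => (IntervalD.aget (TV.ωB j) c).hi

/-- Upper ends of the inverse-weight enclosures: `(ω_j⁻¹)↑`. [folklore] -/
def ωinvhiV (j : ℕ) : Array Dyad := Array.ofFn (n := TV.base.n) fun c => (IntervalD.aget (TV.ωinvB j) c).hi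

/-- The start vector of `a` TRANSPORTED across `m` further chunk boundaries: `T̃_{a/L+m}⋯T̃_{a/L+1}·ũ_a` (rounded up). [folklore] -/
def wVec (j L a : ℕ) : ℕ → Array Dyad
  | 0 => TV.gU j a
  | m + 1 => absMulVecUp TV.base.n TV.prec (TV.gT j (a / L + 1 + m)) (wVec j L a m)

/-- **The growth context of chunk `q` of stage `j`** (chunk length `L`): everything the pass reads, read ONCE; the transported
start vectors `W[a'] = wVec a' (q − (a'/L + 1))` for `a' < qL` precomputed. [folklore] -/
def gctx (j L q : ℕ) : GCtx :=
  { n := TV.base.n, prec := TV.prec, L := L, q := q, S := TV.S j, gL1 := TV.gL1 j, ωhi := TV.ωhiV j, ωinvhi := TV.ωinvhiV j,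
    ΛdesLo := (IntervalD.ofQS2 TV.prec (TV.stageV j).Λdes).lo, ΛLo := (IntervalD.ofQS2 TV.prec (TV.base.stage j).Λ).lo,
    W := Array.ofFn (n := q * L) fun a' => TV.wVec j L a' (q - (a' / L + 1)),
    U := TV.gU j, Tq := TV.gT j q }

/-! ### The mathematical product and the table `G` -/

/-- The kernel box of sub-step `(j, s)`. [folklore] -/
def Mk (j s : ℕ) : Array (Array IntervalD) := (TV.coreVW kitOf wT j s).M

/-- **The interval product `[M_{a+n−1}]⋯[M_a]`** (`n = 0`: identity; `n = 1`: `M_a` itself). [folklore] -/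
def prodM (j a : ℕ) : ℕ → Array (Array IntervalD)
  | 0 => idIM TV.base.n
  | 1 => TV.Mk kitOf wT j a
  | n + 2 => mulII TV.base.n TV.prec (TV.Mk kitOf wT j (a + n + 1)) (prodM j a (n + 1))

/-- **THE GROWTH TABLE `G_j(a,b)` as a dyadic** (`a ≤ b ≤ S`; chunk length `L`): in-chunk pairs by the direct product, cross-chunk
pairs by the split at the boundary `C_{q_b} = q_b·L`, `q_b := (b−1)/L`, of `b`'s chunk with the transported start vector. [folklore] -/
def gD (j L a b : ℕ) : Dyad :=
  if b ≤ (a / L + 1) * L then (TV.gctx j L (a / L)).facOf (TV.prodM kitOf wT j a (b - a)) (TV.ωhiV j)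
  else (TV.gctx j L ((b - 1) / L)).facOf (TV.prodM kitOf wT j ((b - 1) / L * L) (b - (b - 1) / L * L))
    (TV.wVec j L a ((b - 1) / L - (a / L + 1)))

/-- The real table `G` handed to `ReadoutsV`. [folklore] -/
noncomputable def Gr (j L a b : ℕ) : ℝ := (TV.gD kitOf wT j L a b).toReal

/-- The hull multiple `ΛT_j := Λdes_j` handed to `ReadoutsV`. [folklore] -/
noncomputable def ΛTr (j : ℕ) : ℝ := QS2.toRealHom (TV.stageV j).Λdes

/-! ### Tests and the chunk run -/

/-- **(R3b)**: `gL1[a] ≤ Λ_j↓` for every `a < S`, and `0 ≤ Λdes_j`. [folklore] -/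
def checkL1 (j : ℕ) : Bool :=
  decide (0 ≤ (TV.stageV j).Λdes) &&
    allN (TV.S j) fun a => Dyad.ble (dget (TV.gL1 j) a) (IntervalD.ofQS2 TV.prec (TV.base.stage j).Λ).lo

/-- **THE CHUNK RUN**: `k` sub-steps from sub-step `s` and node state `N`, products `pre`: chain Boolean `o.ok`, the caller's
per-sub-step predicate `P s o.core` (e.g. the read-outs' (R4)), the growth step, then recurse on the next node; at the end the
claims. (Pattern of `StageCtx.runFromP`; ONE forward replay serves chain, predicate and growth.) [folklore] -/
def growthRun (P : ℕ → CoreOut → Bool) (j : ℕ) (G : GCtx) : ℕ → ℕ → NodeSt → Array (Array (Array IntervalD)) → Bool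
  | 0, s, _, pre => G.claimsOK s pre
  | k + 1, s, N, pre =>
    let o := (TV.ctxOfW kitOf wT j).subStep s N
    let r := G.step s o.core.M o.core.L1 pre
    ((o.ok && P s o.core) && r.2) && growthRun P j G k (s + 1) o.next r.1

/-- **GROWTH CHUNK CHECK** of chunk `q` of stage `j` (chunk length `L`): the run over sub-steps `[qL, min((q+1)L, S))` from the
chunk's start state `startNode (qL)`. [folklore] -/
def growthRange (P : ℕ → CoreOut → Bool) (j L q : ℕ) : Bool :=
  TV.growthRun kitOf wT P j (TV.gctx j L q) (min L (TV.S j - q * L)) (q * L) ((TV.ctxOfW kitOf wT j).startNode (q * L)) #[]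

/-! ### (R0)/(R1) Booleans -/

/-- Face `l` of ball `j` at the nominal entry point `yb = x j 0`: `|Σ_c ell_{l,c}·yb_c − ctr_l|↑ ≤ rad_l↓`. [folklore] -/
def faceTest0 (j l : ℕ) : Bool :=
  let st := TV.base.stage j
  Dyad.ble
    (IntervalD.mag (IntervalD.subR TV.prec
      (IntervalD.rangeSumR TV.prec
        (fun c => IntervalD.mulDZ TV.prec (dget (TV.stageV j).yb c) (IntervalD.ofQS2 TV.prec (vget (st.ell.getD l []) c)))
        TV.base.n)
      (IntervalD.ofQS2 TV.prec (vget st.ctr l))))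
    (IntervalD.ofQS2 TV.prec (vget st.rad l)).lo

/-- **(R0 b) the base point lies in its polytope**: every listed face of ball `j` passes `faceTest0` (faces beyond the three lists'
lengths are the trivial `|0 − 0| ≤ 0`). [folklore] -/
def checkInPoly0 (j : ℕ) : Bool :=
  let st := TV.base.stage j
  allN (max (max st.ell.length st.ctr.length) st.rad.length) fun l => TV.faceTest0 j l

/-- **(R0 a–d)**: `Tn S ≤ τs` (`TnD S ≤ τs↓`), `0 < γ_j` (exact), `0 ≤ Λdes_j` (exact), base point in the polytope. [folklore] -/
def checkR0 (j : ℕ) : Bool :=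
  Dyad.ble (TV.TnD j (TV.S j)) (IntervalD.ofQS2 TV.prec TV.base.τs).lo && decide (0 < (TV.base.stage j).γ) &&
    decide (0 ≤ (TV.stageV j).Λdes) && TV.checkInPoly0 j

/-- **(R1)**: the emitted tube inflation dominates the scalar recipe, `(Λdes·κ·ω)↑ ≤ wT_j` coordinatewise (reflexively true for
`wT := tubeW`). [folklore] -/
def checkR1 (j : ℕ) : Bool := leVec TV.base.n (TV.tubeW j) (wT j)

end CertTablesV

end Summit.NavierStokesRegularity.NavierStokesRegularity.Theorems.TaylorModelCert
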